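import Literature.AlgebraicTopology.Homotopy.CompactlySupportedSpheres
import Mathlib.LinearAlgebra.Matrix.Transvection
import Mathlib.LinearAlgebra.Matrix.NonsingularInverse
import Mathlib.Topology.Instances.Matrix
import HarnessLib

/-!
# Linear changes of coordinates act on `πₖ(X, x₀)` by the sign of the determinant, I

Topic `Literature/AlgebraicTopology/Homotopy`, continuing `CompactlySupportedSpheres.lean`
(compactly supported spheres `φ : ℝᵏ → X`, `CSphere k X x₀`, and their classes
`toClass φ : π_ k X x₀`). This file proves the classical fact that **precomposing with an
invertible linear map `M` of `ℝᵏ` multiplies the class by `sign (det M)`**: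

* `CSphere.precomp`, `CSphere.precompLin φ M hM`: precomposition with a coercive continuous
  map, resp. with `y ↦ M y` for `det M ≠ 0`;
* `CSphere.toClass_precomp_eq_of_family`: a continuous one-parameter family of coercive
  changes of coordinates does not change the class (a homotopy of spheres);
* `CSphere.toClass_precompLin_transvection` (shears are joined to the identity: class
  unchanged), `CSphere.toClass_precompLin_neg` (reversing one coordinate inverts the class —
  this is Mathlib's `HomotopyGroup.inv_spec`/`GenLoop.symmAt`); `CSphere.signDet M = ±1`, the
  sign of `det M` as an integer exponent.

The conclusion `toClass (φ ∘ M) = (toClass φ) ^ signDet M` for all invertible `M` (via diagonal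
matrices and Mathlib's `Matrix.diagonal_transvection_induction_of_det_ne_zero`) is in the sequel
`LinearActionSign.lean`.

Hatcher, *Algebraic Topology* (2002), §4.1 uses the special cases "reflection reverses, maps in
the identity component preserve" throughout (e.g. p. 341, the action on `πₙ`); the statement for
`GLₖ(ℝ)` is folklore (the two components of `GLₖ(ℝ)` are detected by `sign det`). Everything here
is proved; `[folklore]`.

## References

* A. Hatcher, *Algebraic Topology*, CUP (2002), §4.1, pp. 340–342. [HatcherAT2002]
-/

noncomputable section

open Set Metric unitInterval Topology Matrix
open scoped Topology.Homotopy

universe u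

namespace Literature.AlgebraicTopology.Homotopy

namespace CSphere

variable {k : ℕ} {X : Type u} [TopologicalSpace X] {x₀ : X}

/-! ### Sup-norm estimates for matrices acting on `ℝᵏ` -/

/-- `‖N z‖ ≤ (∑ |Nᵢⱼ|) ‖z‖` for the sup norm. [folklore] -/
theorem norm_mulVec_le (N : Matrix (Fin k) (Fin k) ℝ) (z : Fin k → ℝ) :
    ‖N *ᵥ z‖ ≤ (∑ i, ∑ j, |N i j|) * ‖z‖ := by
  have hnn : 0 ≤ ∑ i, ∑ j, |N i j| :=
    Finset.sum_nonneg fun i _ => Finset.sum_nonneg fun j _ => abs_nonneg _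
  refine (pi_norm_le_iff_of_nonneg (mul_nonneg hnn (norm_nonneg _))).2 fun i => ?_
  rw [Real.norm_eq_abs, mulVec, dotProduct]
  calc |∑ j, N i j * z j| ≤ ∑ j, |N i j * z j| := Finset.abs_sum_le_sum_abs _ _
    _ ≤ ∑ j, |N i j| * ‖z‖ := Finset.sum_le_sum fun j _ => by
        rw [abs_mul]
        gcongr
        rw [← Real.norm_eq_abs]; exact norm_le_pi_norm z j
    _ = (∑ j, |N i j|) * ‖z‖ := by rw [Finset.sum_mul]
    _ ≤ (∑ i, ∑ j, |N i j|) * ‖z‖ :=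
        mul_le_mul_of_nonneg_right (Finset.single_le_sum (f := fun i => ∑ j, |N i j|)
          (fun i _ => Finset.sum_nonneg fun j _ => abs_nonneg _) (Finset.mem_univ i)) (norm_nonneg _)

/-- **Coercivity of invertible matrices**: `‖y‖ ≤ (∑ |(M⁻¹)ᵢⱼ|) ‖M y‖`. [folklore] -/
theorem norm_le_mul_norm_mulVec (M : Matrix (Fin k) (Fin k) ℝ) (hM : M.det ≠ 0)
    (y : Fin k → ℝ) : ‖y‖ ≤ (∑ i, ∑ j, |M⁻¹ i j|) * ‖M *ᵥ y‖ := by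
  have h : y = M⁻¹ *ᵥ (M *ᵥ y) := by
    rw [mulVec_mulVec, nonsing_inv_mul _ (isUnit_iff_ne_zero.2 hM), one_mulVec]
  conv_lhs => rw [h]
  exact norm_mulVec_le _ _

/-! ### Precomposition with coercive changes of coordinates -/

/-- **Precomposition** of a compactly supported sphere with a continuous coercive map
(`‖y‖ ≤ C ‖A y‖`): again a compactly supported sphere. [folklore] -/
def precomp (φ : CSphere k X x₀) (A : (Fin k → ℝ) → (Fin k → ℝ)) (hA : Continuous A) (C : ℝ)
    (hC : ∀ y, ‖y‖ ≤ C * ‖A y‖) : CSphere k X x₀ :=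
  ⟨φ ∘ A, φ.continuous.comp hA, by
    obtain ⟨R, -, hR⟩ := φ.exists_bound_nonneg
    refine ⟨max (C * R) R, fun y hy => hR _ ?_⟩
    have h1 := hC y
    rcases le_or_gt C 0 with hC0 | hC0
    · have : ‖y‖ ≤ 0 := h1.trans (mul_nonpos_of_nonpos_of_nonneg hC0 (norm_nonneg _))
      have hR0 : R ≤ 0 := (le_max_right _ _).trans (hy.trans this)
      exact hR0.trans (norm_nonneg _)
    · have h2 : C * R ≤ C * ‖A y‖ := ((le_max_left _ _).trans hy).trans h1
      exact le_of_mul_le_mul_left h2 hC0⟩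

/-- Unfolding `precomp`. [folklore] -/
@[simp] theorem precomp_apply (φ : CSphere k X x₀) (A : (Fin k → ℝ) → (Fin k → ℝ)) (hA C hC)
    (y : Fin k → ℝ) : precomp φ A hA C hC y = φ (A y) := rfl

/-- `precomp` depends only on the map. [folklore] -/
theorem precomp_congr (φ : CSphere k X x₀) {A : (Fin k → ℝ) → (Fin k → ℝ)} {hA hA' C C' hC hC'} :
    precomp φ A hA C hC = precomp φ A hA' C' hC' := ext fun _ => rfl

/-- Precomposition with the identity. [folklore] -/
theorem precomp_id (φ : CSphere k X x₀) {hA C hC} : precomp φ id hA C hC = φ := ext fun _ => rfl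

/-- **A continuous family of coercive changes of coordinates does not change the class.**
[folklore] -/
theorem toClass_precomp_eq_of_family (φ : CSphere k X x₀) (A : ℝ → (Fin k → ℝ) → (Fin k → ℝ))
    (hA : Continuous fun p : (Fin k → ℝ) × ℝ => A p.2 p.1) (C : ℝ)
    (hC : ∀ s ∈ Icc (0 : ℝ) 1, ∀ y, ‖y‖ ≤ C * ‖A s y‖) {h0 h1 hC0 hC1} :
    (precomp φ (A 0) h0 C hC0).toClass = (precomp φ (A 1) h1 C hC1).toClass := by
  have hAs : ∀ s, Continuous (A s) := fun s =>
    hA.comp (continuous_id.prodMk continuous_const)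
  let Φ : ℝ → CSphere k X x₀ := fun s =>
    precomp φ (A (projIcc 0 1 zero_le_one s)) (hAs _) C (hC _ (projIcc 0 1 zero_le_one s).2)
  have hΦ0 : Φ 0 = precomp φ (A 0) h0 C hC0 := ext fun y => by simp [Φ]
  have hΦ1 : Φ 1 = precomp φ (A 1) h1 C hC1 := ext fun y => by simp [Φ]
  rw [← hΦ0, ← hΦ1]
  obtain ⟨R, -, hR⟩ := φ.exists_bound_nonneg
  refine (homotopic_of_family Φ ?_ (max (C * R) R) fun s _ y hy => ?_).toClass_eq
  · exact φ.continuous.comp (hA.comp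
      (f := fun p : (Fin k → ℝ) × ℝ => (p.1, ((projIcc 0 1 zero_le_one p.2 : I) : ℝ)))
      (by fun_prop))
  · show φ (A _ y) = x₀
    apply hR
    have h1 := hC _ (projIcc 0 1 zero_le_one s).2 y
    rcases le_or_gt C 0 with hC' | hC'
    · have : ‖y‖ ≤ 0 := h1.trans (mul_nonpos_of_nonpos_of_nonneg hC' (norm_nonneg _))
      exact ((le_max_right _ _).trans (hy.trans this)).trans (norm_nonneg _)
    · exact le_of_mul_le_mul_left (((le_max_left _ _).trans hy).trans h1) hC'

/-! ### Linear changes of coordinates -/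

/-- **Precomposition with an invertible linear map** `y ↦ M y`. [folklore] -/
def precompLin (φ : CSphere k X x₀) (M : Matrix (Fin k) (Fin k) ℝ) (hM : M.det ≠ 0) :
    CSphere k X x₀ :=
  precomp φ (M.mulVec) (continuous_const.matrix_mulVec continuous_id) _
    (norm_le_mul_norm_mulVec M hM)

/-- Unfolding `precompLin`. [folklore] -/
@[simp] theorem precompLin_apply (φ : CSphere k X x₀) (M : Matrix (Fin k) (Fin k) ℝ) (hM)
    (y : Fin k → ℝ) : precompLin φ M hM y = φ (M *ᵥ y) := rfl

/-- Precomposition with the identity matrix. [folklore] -/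
theorem precompLin_one (φ : CSphere k X x₀) {h} : precompLin φ 1 h = φ :=
  ext fun y => by simp

/-- Precomposition is contravariantly multiplicative. [folklore] -/
theorem precompLin_mul (φ : CSphere k X x₀) {A B : Matrix (Fin k) (Fin k) ℝ} (hA : A.det ≠ 0)
    (hB : B.det ≠ 0) (hAB : (A * B).det ≠ 0) :
    precompLin φ (A * B) hAB = precompLin (precompLin φ A hA) B hB :=
  ext fun y => by simp [mulVec_mulVec]

/-- The sign `±1` of the determinant, as an integer exponent. [folklore] -/
def signDet (M : Matrix (Fin k) (Fin k) ℝ) : ℤ := if 0 < M.det then 1 else -1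

/-- `signDet` is multiplicative on invertible matrices. [folklore] -/
theorem signDet_mul {A B : Matrix (Fin k) (Fin k) ℝ} (hA : A.det ≠ 0) (hB : B.det ≠ 0) :
    signDet (A * B) = signDet A * signDet B := by
  simp only [signDet, det_mul]
  rcases lt_or_gt_of_ne hA with hA' | hA' <;> rcases lt_or_gt_of_ne hB with hB' | hB'
  · rw [if_pos (mul_pos_of_neg_of_neg hA' hB'), if_neg hA'.not_gt, if_neg hB'.not_gt]; norm_num
  · rw [if_neg (mul_neg_of_neg_of_pos hA' hB').not_gt, if_neg hA'.not_gt, if_pos hB']; norm_num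
  · rw [if_neg (mul_neg_of_pos_of_neg hA' hB').not_gt, if_pos hA', if_neg hB'.not_gt]; norm_num
  · rw [if_pos (mul_pos hA' hB'), if_pos hA', if_pos hB']; norm_num

/-- `signDet` of a matrix of positive determinant. [folklore] -/
theorem signDet_of_pos {M : Matrix (Fin k) (Fin k) ℝ} (h : 0 < M.det) : signDet M = 1 := if_pos h

/-- `signDet` of a matrix of negative determinant. [folklore] -/
theorem signDet_of_neg {M : Matrix (Fin k) (Fin k) ℝ} (h : M.det < 0) : signDet M = -1 :=
  if_neg h.not_gt

/-! #### Transvections (shears) -/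

/-- **Shears do not change the class**: `transvection i j c` is joined to the identity by
`transvection i j (s c)`. [folklore] -/
theorem toClass_precompLin_transvection [NeZero k] (φ : CSphere k X x₀) {i j : Fin k}
    (hij : i ≠ j) (c : ℝ) {h} : (precompLin φ (transvection i j c) h).toClass = φ.toClass := by
  -- the family of shears and its uniform coercivity constant `1 + |c|`
  have hcoer : ∀ s ∈ Icc (0 : ℝ) 1, ∀ y : Fin k → ℝ,
      ‖y‖ ≤ (1 + |c|) * ‖transvection i j (s * c) *ᵥ y‖ := by
    intro s hs y
    set z := transvection i j (s * c) *ᵥ y with hz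
    have hzb : ∀ b, b ≠ i → z b = y b := fun b hb => by
      rw [hz, transvection, add_mulVec, one_mulVec, single_mulVec]
      simp [hb]
    have hzi : z i = y i + s * c * y j := by
      rw [hz, transvection, add_mulVec, one_mulVec, single_mulVec]
      simp
    have hnn : 0 ≤ ‖z‖ := norm_nonneg _
    refine (pi_norm_le_iff_of_nonneg (by positivity)).2 fun b => ?_
    by_cases hb : b = i
    · subst hb
      have h1 : y b = z b - s * c * y j := by rw [hzi]; ring
      have hyj : ‖y j‖ ≤ ‖z‖ := by rw [← hzb j hij.symm]; exact norm_le_pi_norm z j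
      have hzb' : ‖z b‖ ≤ ‖z‖ := norm_le_pi_norm z b
      rw [h1]
      calc ‖z b - s * c * y j‖ ≤ ‖z b‖ + ‖s * c * y j‖ := norm_sub_le _ _
        _ = ‖z b‖ + |s| * |c| * ‖y j‖ := by
            rw [norm_mul, norm_mul, Real.norm_eq_abs s, Real.norm_eq_abs c]
        _ ≤ ‖z‖ + 1 * |c| * ‖z‖ := by
            gcongr
            rw [abs_of_nonneg hs.1]; exact hs.2
        _ = (1 + |c|) * ‖z‖ := by ring
    · rw [← hzb b hb]
      calc ‖z b‖ ≤ ‖z‖ := norm_le_pi_norm z b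
        _ = 1 * ‖z‖ := (one_mul _).symm
        _ ≤ (1 + |c|) * ‖z‖ := by gcongr; linarith [abs_nonneg c]
  have hcont : Continuous fun p : (Fin k → ℝ) × ℝ => transvection i j (p.2 * c) :=
    continuous_matrix fun a b => by
      simp only [transvection, Matrix.add_apply, Matrix.single, Matrix.of_apply]
      refine Continuous.add continuous_const ?_
      split_ifs
      · fun_prop
      · exact continuous_const
  have hfam := toClass_precomp_eq_of_family φ (fun s => (transvection i j (s * c)).mulVec)
    (hcont.matrix_mulVec continuous_fst) (1 + |c|) hcoer
    (h0 := continuous_const.matrix_mulVec continuous_id)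
    (h1 := continuous_const.matrix_mulVec continuous_id)
    (hC0 := hcoer 0 ⟨le_rfl, zero_le_one⟩) (hC1 := hcoer 1 ⟨zero_le_one, le_rfl⟩)
  have hzero : precomp φ (transvection i j ((0 : ℝ) * c)).mulVec
      (continuous_const.matrix_mulVec continuous_id) (1 + |c|) (hcoer 0 ⟨le_rfl, zero_le_one⟩) = φ :=
    ext fun y => by simp
  have hone : precomp φ (transvection i j ((1 : ℝ) * c)).mulVec
      (continuous_const.matrix_mulVec continuous_id) (1 + |c|) (hcoer 1 ⟨zero_le_one, le_rfl⟩) =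
      precompLin φ (transvection i j c) h := ext fun y => by simp
  rw [← hone, ← hfam, hzero]

/-! #### Reversing one coordinate -/

/-- The diagonal matrix reversing the coordinate `b`. [folklore] -/
def negMatrix (b : Fin k) : Matrix (Fin k) (Fin k) ℝ := diagonal fun m => if m = b then -1 else 1

/-- `negMatrix b` acts by reversing the coordinate `b`. [folklore] -/
theorem negMatrix_mulVec (b : Fin k) (y : Fin k → ℝ) (m : Fin k) :
    (negMatrix b *ᵥ y) m = if m = b then -y m else y m := by
  rw [negMatrix, mulVec_diagonal]
  split_ifs <;> simp

/-- `det (negMatrix b) = -1`. [folklore] -/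
theorem det_negMatrix (b : Fin k) : (negMatrix b).det = -1 := by
  rw [negMatrix, det_diagonal, Finset.prod_ite_eq']
  simp

/-- **Reversing one coordinate inverts the class** (Mathlib's `HomotopyGroup.inv_spec`: the
inverse in `πₖ` is represented by `GenLoop.symmAt b`, the reversal of the coordinate `b`).
[folklore] -/
theorem toClass_precompLin_neg [NeZero k] (φ : CSphere k X x₀) (b : Fin k) {h} :
    (precompLin φ (negMatrix b) h).toClass = φ.toClass⁻¹ := by
  obtain ⟨R, hR0, hR⟩ := φ.exists_bound_nonneg
  have hnorm : ∀ y : Fin k → ℝ, ‖negMatrix b *ᵥ y‖ = ‖y‖ := fun y => by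
    simp only [Pi.norm_def]
    congr 1
    refine Finset.sup_congr rfl fun m _ => ?_
    rw [negMatrix_mulVec]
    split_ifs <;> simp
  have hR' : ∀ y, R ≤ ‖y‖ → precompLin φ (negMatrix b) h y = x₀ := fun y hy => by
    rw [precompLin_apply]; exact hR _ (by rw [hnorm]; exact hy)
  rw [(precompLin φ (negMatrix b) h).toClass_eq hR0 hR', φ.toClass_eq hR0 hR,
    HomotopyGroup.inv_spec (i := b)]
  congr 1
  refine Subtype.ext (ContinuousMap.ext fun z => ?_)
  show φ (negMatrix b *ᵥ stretch R z) = φ (stretch R fun j => if j = b then σ (z b) else z j)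
  congr 1
  funext m
  rw [negMatrix_mulVec]
  by_cases hm : m = b
  · subst hm; simp [stretch]; ring
  · simp [stretch, hm]

end CSphere

end Literature.AlgebraicTopology.Homotopy

end
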